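import Literature.NumberTheory.Automorphic.UnitaryRepKCasimirBlockBound
import Literature.NumberTheory.Automorphic.HilbertRepEquivalentBlocksCount
import Literature.Analysis.SpecialFunctions.LatticeSumsPolynomialWeight
import HarnessLib

/-!
# The block Casimir-weight sum `Σ_W dim W · (1 + q_W)^{-n}` converges, GIVEN a `ℤ³`-label of the `K`-blocks (Varadarajan §5.4 Lemma 21 in block form)

Topic `NumberTheory/Automorphic`; namespace `Literature.NumberTheory.Automorphic`; theorems only (no definition, no named fact, no instance, no `sorry`).  Cell
`hodgecm-mathlib`, line T1a, road HC, piece `hsum` of the assembly skeleton ★ `UnitaryGroup.archIntegratedOperatorNuclearOfKTypeGrowth_of_pieces` (lead F0P3b-p01 (g2)),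
REDUCED to the `Û(α)×Û(β)`-dictionary data of node H4b: for a unitary strongly continuous `ϖ` of `U(α, β)` with the `K`-type growth hypothesis of ★ V22 and a pairwise
orthogonal set `S` of irreducible finite-dimensional closed `K`-blocks, SUPPOSE each block carries a label `w W ∈ ℤ × ℤ × ℤ` with
(D2) `dim W ≤ C (1 + |(w W).1|)`, (D4′) equal labels ⇒ unitarily equivalent blocks, and (hq) `δ (1 + a² + b² + c²) ≤ 1 + q_W` (`q_W` = ★ `upqKBlockScalar`, A-p14);
THEN `Σ_{W ∈ S} dim W · (1 + q_W)^{-n} < ∞` for `n = r + 3` (`r` the growth exponent).  Ingredients: the fibre count ★ `finite_and_ncard_le_of_finrank_homRangeSum_le` (G1,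
p830066: `#{W ∈ S | W ≃ W₀} ≤ c · (dim W₀)^r` from `dim E(τ₀) ≤ c (dim W₀)^{r+1}`) and the lattice sum ★ `summable_pow_mul_rpow_neg_of_label_fiber_le_pow` (A-p06, p829656 ED. 2).

* `summable_finrank_mul_inv_pow_casimir_of_label` — the statement above.

## References
* V. S. Varadarajan, *An Introduction to Harmonic Analysis on Semisimple Lie Groups* (1989), §5.4 Lemma 21, Thm. 19, Thm. 22 [Varadarajan1989].
* A. W. Knapp, *Representation Theory of Semisimple Groups: An Overview Based on Examples* (1986), Thm. 10.2 (proof) [Knapp1986].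
-/

set_option autoImplicit false

noncomputable section

open scoped InnerProductSpace
open Literature.Analysis.SpecialFunctions

namespace Literature.NumberTheory.Automorphic

open Literature.RepresentationTheory.KonnoKonno2007 Literature.RepresentationTheory.KonnoKonno2007.RealDualPair

variable {α β : Type} [Fintype α] [DecidableEq α] [Fintype β] [DecidableEq β]
  {E : Type} [NormedAddCommGroup E] [InnerProductSpace ℂ E]
  (ϖ : ContRepresentation ℂ (uFormGroup α β).carrier E)

/-- **LEMMA 21 IN BLOCK FORM, GIVEN THE DICTIONARY**: under the `K`-type growth hypothesis of ★ V22 (`dim E(τ) < ∞`, `dim E(τ) ≤ c · d(τ)^r` for irreducible `τ`), for a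
pairwise orthogonal set `S` of topologically irreducible finite-dimensional closed `K`-blocks of `ϖ|_K` labelled by `w : S → ℤ × ℤ × ℤ` with `dim W ≤ C (1 + |(w W).1|)`,
`w W = w W' ⇒ W ≃ W'`, and `δ (1 + a² + b² + c²) ≤ 1 + q_W` (`δ > 0`, `q_W` = ★ `upqKBlockScalar ϖ W`), the block Casimir-weight sum converges:
`Summable (W ↦ dim W · ((1 + q_W)^(r+3))⁻¹)`. [cite: Varadarajan1989, §5.4 Lemma 21, Thm. 19, proof of Thm. 22] [cite: Knapp1986, Thm. 10.2 (proof)] -/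
theorem summable_finrank_mul_inv_pow_casimir_of_label
    {c : ℝ} {r : ℕ}
    (hgr : ∀ (W : Type) [AddCommGroup W] [Module ℂ W] [FiniteDimensional ℂ W]
        (τ : Representation ℂ (uFormGroup α β).maximalCompact W), τ.IsIrreducible →
        FiniteDimensional ℂ (Representation.homRangeSum
            (ϖ.restrict (Subgroup.inclusion (uFormGroup α β).maximalCompact_le_carrier)).toRepresentation τ) ∧
          (Module.finrank ℂ (Representation.homRangeSum
              (ϖ.restrict (Subgroup.inclusion (uFormGroup α β).maximalCompact_le_carrier)).toRepresentation τ) : ℝ) ≤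
            c * (Module.finrank ℂ W : ℝ) ^ r)
    {S : Set (ContRepresentation.ClosedSubrep (ϖ.restrict (Subgroup.inclusion (uFormGroup α β).maximalCompact_le_carrier)))}
    (horth : S.Pairwise (fun W W' => W.toSubmodule ⟂ W'.toSubmodule))
    (hirr : ∀ W ∈ S, W.toContRep.IsTopIrreducible) (hfd : ∀ W ∈ S, FiniteDimensional ℂ W.toSubmodule)
    (w : S → ℤ × ℤ × ℤ) {C δ : ℝ} (hδ : 0 < δ)
    (hd : ∀ W : S, (Module.finrank ℂ (W : ContRepresentation.ClosedSubrep
        (ϖ.restrict (Subgroup.inclusion (uFormGroup α β).maximalCompact_le_carrier))).toSubmodule : ℝ) ≤ C * (1 + |((w W).1 : ℝ)|))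
    (hD4 : ∀ W W' : S, w W = w W' →
        ContRepresentation.AreUnitarilyEquivalent
          (W : ContRepresentation.ClosedSubrep (ϖ.restrict (Subgroup.inclusion (uFormGroup α β).maximalCompact_le_carrier))).toContRep
          (W' : ContRepresentation.ClosedSubrep (ϖ.restrict (Subgroup.inclusion (uFormGroup α β).maximalCompact_le_carrier))).toContRep)
    (hq : ∀ W : S, δ * (1 + (((w W).1 : ℝ) ^ 2 + ((w W).2.1 : ℝ) ^ 2 + ((w W).2.2 : ℝ) ^ 2)) ≤
        1 + upqKBlockScalar ϖ (W : ContRepresentation.ClosedSubrep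
          (ϖ.restrict (Subgroup.inclusion (uFormGroup α β).maximalCompact_le_carrier))).toSubmodule) :
    Summable fun W : S =>
      (Module.finrank ℂ (W : ContRepresentation.ClosedSubrep
        (ϖ.restrict (Subgroup.inclusion (uFormGroup α β).maximalCompact_le_carrier))).toSubmodule : ℝ) *
        ((1 + upqKBlockScalar ϖ (W : ContRepresentation.ClosedSubrep
          (ϖ.restrict (Subgroup.inclusion (uFormGroup α β).maximalCompact_le_carrier))).toSubmodule) ^ (r + 3))⁻¹ := by
  -- abbreviations
  let d : S → ℝ := fun W => (Module.finrank ℂ (W : ContRepresentation.ClosedSubrep (ϖ.restrict (Subgroup.inclusion (uFormGroup α β).maximalCompact_le_carrier))).toSubmodule : ℝ)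
  let q : S → ℝ := fun W => 1 + upqKBlockScalar ϖ (W : ContRepresentation.ClosedSubrep (ϖ.restrict (Subgroup.inclusion (uFormGroup α β).maximalCompact_le_carrier))).toSubmodule
  have hq0 : ∀ W : S, 0 < q W := fun W => by
    have := upqKBlockScalar_nonneg ϖ (W : ContRepresentation.ClosedSubrep (ϖ.restrict (Subgroup.inclusion (uFormGroup α β).maximalCompact_le_carrier))).toSubmodule
    change 0 < 1 + _; linarith
  -- the fibre of the label through a block `W₀` sits inside `{W ∈ S | W ≃ W₀}`
  have hfibre : ∀ W₀ : S, (w ⁻¹' {w W₀}).Finite ∧ (Nat.card (w ⁻¹' {w W₀}) : ℝ) ≤ c * (1 + |((w W₀).1 : ℝ)|) ^ r * (max C 1) ^ r := by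
    intro W₀
    haveI : FiniteDimensional ℂ (W₀ : ContRepresentation.ClosedSubrep (ϖ.restrict (Subgroup.inclusion (uFormGroup α β).maximalCompact_le_carrier))).toSubmodule := hfd W₀ W₀.2
    have hirr₀ : (W₀ : ContRepresentation.ClosedSubrep (ϖ.restrict (Subgroup.inclusion (uFormGroup α β).maximalCompact_le_carrier))).toContRep.toRepresentation.IsIrreducible :=
      isIrreducible_of_isTopIrreducible_block _ (hirr W₀ W₀.2)
    obtain ⟨hfinE, hle⟩ := hgr _ (W₀ : ContRepresentation.ClosedSubrep (ϖ.restrict (Subgroup.inclusion (uFormGroup α β).maximalCompact_le_carrier))).toContRep.toRepresentation hirr₀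
    haveI := hfinE
    have h0 : (W₀ : ContRepresentation.ClosedSubrep (ϖ.restrict (Subgroup.inclusion (uFormGroup α β).maximalCompact_le_carrier))).toSubmodule ≠ ⊥ := by
      intro hbot
      have hnt : Nontrivial (W₀ : ContRepresentation.ClosedSubrep (ϖ.restrict (Subgroup.inclusion (uFormGroup α β).maximalCompact_le_carrier))).toSubmodule :=
        ((ContRepresentation.isTopIrreducible_iff _).1 (hirr W₀ W₀.2)).1
      exact (Submodule.nontrivial_iff_ne_bot.1 hnt) hbot
    have hd1 : (1 : ℝ) ≤ d W₀ := by
      have h1 : 1 ≤ Module.finrank ℂ (W₀ : ContRepresentation.ClosedSubrep (ϖ.restrict (Subgroup.inclusion (uFormGroup α β).maximalCompact_le_carrier))).toSubmodule :=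
        Module.finrank_pos_iff.2 (Submodule.nontrivial_iff_ne_bot.2 h0)
      change (1 : ℝ) ≤ (Module.finrank ℂ (W₀ : ContRepresentation.ClosedSubrep
        (ϖ.restrict (Subgroup.inclusion (uFormGroup α β).maximalCompact_le_carrier))).toSubmodule : ℝ)
      exact_mod_cast h1
    have hc0 : 0 ≤ c := by
      have h1 : (0 : ℝ) < Module.finrank ℂ (Representation.homRangeSum (ϖ.restrict (Subgroup.inclusion (uFormGroup α β).maximalCompact_le_carrier)).toRepresentation
          (W₀ : ContRepresentation.ClosedSubrep (ϖ.restrict (Subgroup.inclusion (uFormGroup α β).maximalCompact_le_carrier))).toContRep.toRepresentation) := by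
        have hleW := toSubmodule_le_homRangeSum_of_areUnitarilyEquivalent
          (ContRepresentation.AreUnitarilyEquivalent.refl (W₀ : ContRepresentation.ClosedSubrep (ϖ.restrict (Subgroup.inclusion (uFormGroup α β).maximalCompact_le_carrier))).toContRep)
        have := Submodule.finrank_mono hleW
        exact_mod_cast lt_of_lt_of_le (Module.finrank_pos_iff.2 (Submodule.nontrivial_iff_ne_bot.2 h0)) this
      have h2 : 0 < d W₀ ^ r := pow_pos (by linarith) r
      nlinarith [hle, h1, h2, mul_pos_iff.1 (lt_of_lt_of_le h1 hle)]
    -- growth with exponent `r + 1`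
    have hle' : (Module.finrank ℂ (Representation.homRangeSum (ϖ.restrict (Subgroup.inclusion (uFormGroup α β).maximalCompact_le_carrier)).toRepresentation
        (W₀ : ContRepresentation.ClosedSubrep (ϖ.restrict (Subgroup.inclusion (uFormGroup α β).maximalCompact_le_carrier))).toContRep.toRepresentation) : ℝ) ≤ c * (d W₀) ^ (r + 1) := by
      refine hle.trans ?_
      rw [pow_succ]
      have : c * d W₀ ^ r * 1 ≤ c * d W₀ ^ r * d W₀ := mul_le_mul_of_nonneg_left hd1 (mul_nonneg hc0 (pow_nonneg (by linarith) r))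
      linarith
    obtain ⟨hF, hN⟩ := finite_and_ncard_le_of_finrank_homRangeSum_le horth h0 hle'
    -- the fibre injects into `{W ∈ S | W ≃ W₀}` by `Subtype.val`
    have hsub : Subtype.val '' (w ⁻¹' {w W₀}) ⊆
        {W ∈ S | ContRepresentation.AreUnitarilyEquivalent W.toContRep (W₀ : ContRepresentation.ClosedSubrep (ϖ.restrict (Subgroup.inclusion (uFormGroup α β).maximalCompact_le_carrier))).toContRep} := by
      rintro _ ⟨W, hW, rfl⟩
      exact ⟨W.2, hD4 W W₀ hW⟩
    have hfinF : (w ⁻¹' {w W₀}).Finite :=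
      (hF.subset hsub).of_finite_image Subtype.val_injective.injOn
    refine ⟨hfinF, ?_⟩
    have hcard : (Nat.card (w ⁻¹' {w W₀}) : ℝ) ≤
        ({W ∈ S | ContRepresentation.AreUnitarilyEquivalent W.toContRep (W₀ : ContRepresentation.ClosedSubrep (ϖ.restrict (Subgroup.inclusion (uFormGroup α β).maximalCompact_le_carrier))).toContRep}.ncard : ℝ) := by
      have h1 : Nat.card (w ⁻¹' {w W₀}) = (Subtype.val '' (w ⁻¹' {w W₀})).ncard := by
        rw [Set.ncard_image_of_injective _ Subtype.val_injective, Nat.card_coe_set_eq]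
      rw [h1]
      exact_mod_cast Set.ncard_le_ncard hsub hF
    refine hcard.trans (hN.trans ?_)
    -- `c · (dim W₀)^r ≤ c · (C(1+|a|))^r ≤ c (1+|a|)^r (max C 1)^r`
    have hdle : d W₀ ≤ max C 1 * (1 + |((w W₀).1 : ℝ)|) := by
      refine (hd W₀).trans ?_
      exact mul_le_mul_of_nonneg_right (le_max_left C 1) (by positivity)
    calc c * d W₀ ^ r ≤ c * (max C 1 * (1 + |((w W₀).1 : ℝ)|)) ^ r :=
          mul_le_mul_of_nonneg_left (pow_le_pow_left₀ (by linarith) hdle r) hc0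
      _ = c * (1 + |((w W₀).1 : ℝ)|) ^ r * (max C 1) ^ r := by rw [mul_pow]; ring
  -- the lattice sum with polynomial fibre bound, `k = 1`, `N = r + 3`
  have hfin' : ∀ t, (w ⁻¹' {t}).Finite := by
    intro t
    by_cases ht : ∃ W₀ : S, w W₀ = t
    · obtain ⟨W₀, rfl⟩ := ht
      exact (hfibre W₀).1
    · have h0 : w ⁻¹' {t} = ∅ := Set.eq_empty_iff_forall_notMem.2 fun W hW => ht ⟨W, hW⟩
      rw [h0]; exact Set.finite_empty
  have hfib' : ∀ t, (Nat.card (w ⁻¹' {t}) : ℝ) ≤ (max c 0 * (max C 1) ^ r) * (1 + |(t.1 : ℝ)|) ^ r := by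
    intro t
    by_cases ht : ∃ W₀ : S, w W₀ = t
    · obtain ⟨W₀, rfl⟩ := ht
      refine (hfibre W₀).2.trans ?_
      have h1 : c * (1 + |((w W₀).1 : ℝ)|) ^ r * (max C 1) ^ r ≤ max c 0 * (1 + |((w W₀).1 : ℝ)|) ^ r * (max C 1) ^ r :=
        mul_le_mul_of_nonneg_right (mul_le_mul_of_nonneg_right (le_max_left c 0) (by positivity)) (by positivity)
      linarith [h1]
    · have h0 : w ⁻¹' {t} = ∅ := Set.eq_empty_iff_forall_notMem.2 fun W hW => ht ⟨W, hW⟩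
      rw [h0, Nat.card_coe_set_eq, Set.ncard_empty, Nat.cast_zero]
      positivity
  have hd0' : ∀ W : S, 0 ≤ d W := fun W => by positivity
  have hd' : ∀ W : S, d W ≤ max C 1 * (1 + |((w W).1 : ℝ)|) := fun W =>
    (hd W).trans (mul_le_mul_of_nonneg_right (le_max_left C 1) (by positivity))
  have hq' : ∀ W : S, δ * (1 + (((w W).1 : ℝ) ^ 2 + ((w W).2.1 : ℝ) ^ 2 + ((w W).2.2 : ℝ) ^ 2)) ≤ q W := fun W => hq W
  have hN : (((1 + r : ℕ) : ℝ)) + 3 < 2 * (((r + 3 : ℕ) : ℝ)) := by push_cast; linarith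
  have hsum := summable_pow_mul_rpow_neg_of_label_fiber_le_pow w hfin' r hfib' hδ hd0' hd' hq' 1 hN
  -- convert `d^1 · q^(-(r+3))` to `dim W · ((1+q_W)^(r+3))⁻¹`
  refine hsum.congr fun W => ?_
  simp only [d, q, pow_one]
  rw [Real.rpow_neg (hq0 W).le, Real.rpow_natCast]

end Literature.NumberTheory.Automorphic

end
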